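import Mathlib
import Summits.Ventures.PercRepro2.Defs
import Summits.Ventures.PercRepro2.Graph
import Summits.Ventures.PercRepro2.OneColourSwitch
import Summits.Ventures.PercRepro2.RegionHubSign
import Summits.Ventures.PercRepro2.SideSwitch
import Summits.Ventures.PercRepro2.SideSwitchClosed
import Summits.Ventures.PercRepro2.SideSwitchComps
import Summits.Ventures.PercRepro2.SideSwitchFibre
import Summits.Ventures.PercRepro2.TermSwitchDefs
import Summits.Ventures.PercRepro2.TermSwitchFibre
import Summits.Ventures.PercRepro2.TermSwitchCompsFibre
import Summits.Ventures.PercRepro2.TermSwitchMono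
import Summits.Ventures.PercRepro2.TermSwitchReach

/-!
# The one-sided points of a three-terminal fibre are a corner pair (blind cell PercRepro2, p3 g30,
2026-08-28; `proofs/P3-HDR.md` §10(c))

In the three-terminal fibration (`H = {r, s, d}`, representative `ρ ∈ RepH` with every block on
the `Y`-side, the switches `assignC T ρ` for `T ⊆ compsH ρ`), when `d` is adjacent to neither
`r` nor `s` and there is no `r–s` edge, a `Y`-path from `d` to `r` or `s` runs through a single
block: `d ∈ K₂(ρ_T)` iff some UNSWITCHED block **joins** `d` to `r` or `s` (`joinsB`: a `Y`-path
inside the block and its terminal edges), and `d ∈ M₂(ρ_T)` iff some SWITCHED block joins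
(`mem_K2_assignC_iff_joins`, `mem_M2_assignC_iff_joins`).  Hence `d` lies in exactly one world
iff `T` lies in the corner pair of the joining blocks `F`
(`oneSided_assignC_iff_corners`): `F ≠ ∅` and (`F ∩ T = ∅` or `F ⊆ T`).  Own work; std axioms.
-/

namespace Summit.Ventures.PercRepro2

namespace TermSwitch

open Finset Classical RegionHub OneColourSwitch SideSwitch

variable {V : Type*} {E : Type*}

section Joins

variable [Fintype V] [DecidableEq V] {ends : E → Sym2 V} {p q r s d : V}

/-- The configuration of `ρ` restricted to the edges inside `B ∪ {r, s, d}`. -/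
noncomputable def inB (ends : E → Sym2 V) (r s d : V) (B : Finset V) (ρ : Config E) : Config E :=
  fun e => if e ∈ within ends ((↑B : Set V) ∪ {r, s, d}) then ρ e else false

/-- A block **joins** `d` to `{r, s}`: a `Y`-path from `d` to `r` or to `s` inside the block and
its terminal edges. -/
def joinsB (ends : E → Sym2 V) (r s d : V) (B : Finset V) (ρ : Config E) : Prop :=
  Conn ends (inB ends r s d B ρ) d r ∨ Conn ends (inB ends r s d B ρ) d s

/-- The joining blocks of a representative. -/
noncomputable def joinSet (ends : E → Sym2 V) (r s d : V) (ρ : Config E) : Finset (Finset V) :=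
  (compsH ends ({r, s, d} : Set V) ρ).filter (fun B => joinsB ends r s d B ρ)

/-- The hypotheses on the terminals: pairwise distinct, no edge between two of them. -/
structure TFree (ends : E → Sym2 V) (r s d : V) : Prop where
  rs : r ≠ s
  rd : r ≠ d
  sd : s ≠ d
  no_rs : ∀ e, ends e ≠ s(r, s)
  no_dr : ∀ e, ends e ≠ s(d, r)
  no_ds : ∀ e, ends e ≠ s(d, s)

variable (hT : TFree ends r s d)

omit [Fintype V] [DecidableEq V] in
/-- An open edge of `inB` is an edge of `ρ` inside `B ∪ {r, s, d}`. -/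
lemma inB_eq_true_iff {B : Finset V} {ρ : Config E} {e : E} :
    inB ends r s d B ρ e = true ↔ e ∈ within ends ((↑B : Set V) ∪ {r, s, d}) ∧ ρ e = true := by
  unfold inB
  split_ifs with h
  · exact ⟨fun h' => ⟨h, h'⟩, fun h' => h'.2⟩
  · exact ⟨fun h' => absurd h' (by decide), fun h' => absurd h'.1 h⟩

omit [Fintype V] [DecidableEq V] in
/-- No edge joins two terminals. -/
lemma no_terminal_edge (hT : TFree ends r s d) {e : E} {x y : V} (hends : ends e = s(x, y))
    (hne : x ≠ y) (hx : x ∈ ({r, s, d} : Set V)) (hy : y ∈ ({r, s, d} : Set V)) : False := by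
  simp only [Set.mem_insert_iff, Set.mem_singleton_iff] at hx hy
  rcases hx with rfl | rfl | rfl <;> rcases hy with rfl | rfl | rfl
  · exact hne rfl
  · exact hT.no_rs e hends
  · exact hT.no_dr e (by rw [hends, Sym2.eq_swap])
  · exact hT.no_rs e (by rw [hends, Sym2.eq_swap])
  · exact hne rfl
  · exact hT.no_ds e (by rw [hends, Sym2.eq_swap])
  · exact hT.no_dr e hends
  · exact hT.no_ds e hends
  · exact hne rfl

omit [Fintype V] [DecidableEq V] in
/-- In a representative, an edge from a terminal to a sided vertex is `Y`. -/
lemma edge_term_sided_true {ρ : Config E} (hρ : ∀ x ∈ MH ends ({r, s, d} : Set V) ρ,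
    x ∈ ({r, s, d} : Set V)) {e : E} {t x : V} (hends : ends e = s(t, x))
    (ht : t ∈ ({r, s, d} : Set V)) (hx : x ∉ ({r, s, d} : Set V)) : ρ e = true := by
  by_contra h
  rw [Bool.not_eq_true] at h
  have hxM : x ∈ MH ends ({r, s, d} : Set V) ρ :=
    mem_MH_iff.2 ⟨t, ht, conn_of_openAdj ⟨e, by simp [OneColourSwitch.compl, h], hends⟩⟩
  exact hx (hρ x hxM)

omit [Fintype V] [DecidableEq V] in
/-- An edge from a vertex of the `Y`-world to a vertex outside both worlds is `W`. -/
lemma edge_KH_out_false {ρ : Config E} {e : E} {x y : V} (hends : ends e = s(x, y))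
    (hx : x ∈ KH ends ({r, s, d} : Set V) ρ) (hy : y ∉ KH ends ({r, s, d} : Set V) ρ) :
    ρ e = false := by
  by_contra h
  rw [Bool.not_eq_false] at h
  obtain ⟨t, ht, hc⟩ := mem_KH_iff.1 hx
  exact hy (mem_KH_iff.2 ⟨t, ht, conn_trans hc (conn_of_openAdj ⟨e, h, hends⟩)⟩)

/-- Two components sharing a vertex coincide. -/
lemma eq_of_mem_compsH_of_mem {H : Set V} {ρ : Config E} {B B' : Finset V}
    (hB : B ∈ compsH ends H ρ) (hB' : B' ∈ compsH ends H ρ) {x : V} (hx : x ∈ B) (hx' : x ∈ B') :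
    B = B' := by
  rw [eq_compIn_of_mem_compsH hB hx, eq_compIn_of_mem_compsH hB' hx']

/-- An unswitched block is disjoint from the switched vertices. -/
lemma notMem_unionT_of_mem_of_notMem {H : Set V} {ρ : Config E} {T : Finset (Finset V)}
    (hT : T ⊆ compsH ends H ρ) {B : Finset V} (hB : B ∈ compsH ends H ρ) (hBT : B ∉ T) {x : V}
    (hx : x ∈ B) : x ∉ unionT T := by
  intro hxU
  obtain ⟨B', hB'T, hxB'⟩ := mem_unionT.1 hxU
  exact hBT (eq_of_mem_compsH_of_mem hB (hT hB'T) hx hxB' ▸ hB'T)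

/-- A sided vertex adjacent to a vertex of a block lies in the block. -/
lemma mem_of_adj_of_mem_compsH {H : Set V} {ρ : Config E} {B : Finset V}
    (hB : B ∈ compsH ends H ρ) {e : E} {x y : V} (hends : ends e = s(x, y)) (hx : x ∈ B)
    (hy : y ∈ A0H ends H ρ) : y ∈ B := by
  have hcl := closedIn_of_mem_compsH hB
  rw [sidedH_eq_coe_A0H] at hcl
  exact Finset.mem_coe.1 (hcl e x y hends (Finset.mem_coe.2 hx) (Finset.mem_coe.2 hy))

end Joins

section Claims

variable [Fintype V] [DecidableEq V] {ends : E → Sym2 V} {p q r s d : V}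

omit [Fintype V] in
/-- `assignC` is the switch of the union. -/
lemma assignC_eq_flipTouch (T : Finset (Finset V)) (ρ : Config E) :
    assignC ends T ρ = flipTouch ends (↑(unionT T) : Set V) ρ := rfl

/-- A terminal is not a switched vertex. -/
lemma term_notMem_unionT {H : Set V} {ρ : Config E} {T : Finset (Finset V)}
    (hT : T ⊆ compsH ends H ρ) {t : V} (ht : t ∈ H) : t ∉ unionT T := by
  intro h
  exact (mem_A0H.1 (unionT_subset_A0H hT h)).2 ht

/-- A vertex outside both worlds is not a switched vertex. -/
lemma out_notMem_unionT {H : Set V} {ρ : Config E} {T : Finset (Finset V)}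
    (hT : T ⊆ compsH ends H ρ) {x : V} (hx : x ∉ KH ends H ρ ∪ MH ends H ρ) : x ∉ unionT T := by
  intro h
  exact hx (mem_A0H.1 (unionT_subset_A0H hT h)).1

omit [Fintype V] in
/-- The switched colouring on an edge with no end in the union. -/
lemma assignC_eq_of_notMem {T : Finset (Finset V)} {ρ : Config E} {e : E} {x y : V}
    (hends : ends e = s(x, y)) (hx : x ∉ unionT T) (hy : y ∉ unionT T) :
    assignC ends T ρ e = ρ e := by
  rw [assignC_eq_flipTouch]
  refine flipTouch_of_notMem ends ?_
  rintro ⟨z, hz, w, hzw⟩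
  rw [hends] at hzw
  rcases Sym2.eq_iff.1 hzw with ⟨rfl, _⟩ | ⟨_, rfl⟩
  · exact hx (Finset.mem_coe.1 hz)
  · exact hy (Finset.mem_coe.1 hz)

omit [Fintype V] in
/-- The switched colouring on an edge with an end in the union. -/
lemma assignC_eq_not_of_mem {T : Finset (Finset V)} {ρ : Config E} {e : E} {x y : V}
    (hends : ends e = s(x, y)) (h : x ∈ unionT T ∨ y ∈ unionT T) :
    assignC ends T ρ e = !ρ e := by
  rw [assignC_eq_flipTouch]
  refine flipTouch_of_mem ends ?_
  rcases h with h | h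
  · exact ⟨x, Finset.mem_coe.2 h, y, hends⟩
  · exact ⟨y, Finset.mem_coe.2 h, x, by rw [hends, Sym2.eq_swap]⟩

omit [DecidableEq V] in
/-- A sided vertex of a representative (`MH ⊆ H`) lies in the `Y`-world. -/
lemma mem_KH_of_mem_A0H {H : Set V} {ρ : Config E} (hρ : ∀ x ∈ MH ends H ρ, x ∈ H) {x : V}
    (hx : x ∈ A0H ends H ρ) : x ∈ KH ends H ρ := by
  obtain ⟨h1, h2⟩ := mem_A0H.1 hx
  rcases h1 with h | h
  · exact h
  · exact absurd (hρ x h) h2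

/-- A sided vertex lies in a block. -/
lemma exists_block_of_mem_A0H {H : Set V} {ρ : Config E} {x : V} (hx : x ∈ A0H ends H ρ) :
    ∃ B ∈ compsH ends H ρ, x ∈ B :=
  ⟨compIn ends (↑(A0H ends H ρ) : Set V) x, Finset.mem_image_of_mem _ hx, mem_compIn_self _ _⟩

omit [DecidableEq V] in
/-- The terminals are not in `A0H`. -/
lemma term_notMem_A0H {H : Set V} {ρ : Config E} {t : V} (ht : t ∈ H) : t ∉ A0H ends H ρ :=
  fun h => (mem_A0H.1 h).2 ht

/-- **`d ∈ K₂` after the switch iff an unswitched block joins `d` to `{r, s}`.** -/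
theorem mem_K2_assignC_iff_joins (hT : TFree ends r s d) {ρ : Config E}
    (hρ : ∀ x ∈ MH ends ({r, s, d} : Set V) ρ, x ∈ ({r, s, d} : Set V))
    {T : Finset (Finset V)} (hTc : T ⊆ compsH ends ({r, s, d} : Set V) ρ) :
    d ∈ K2 ends r s (assignC ends T ρ) ↔
      ∃ B ∈ compsH ends ({r, s, d} : Set V) ρ, B ∉ T ∧ joinsB ends r s d B ρ := by
  have hd : d ∈ ({r, s, d} : Set V) := d_mem_triple r s d
  have hr : r ∈ ({r, s, d} : Set V) := r_mem_triple r s d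
  have hs : s ∈ ({r, s, d} : Set V) := s_mem_triple r s d
  constructor
  · intro hK
    by_contra hno
    simp only [not_exists, not_and] at hno
    -- the vertices reached from `d` inside unswitched blocks
    have key : ∀ v, v ∈ {x | x = d ∨ ∃ B ∈ compsH ends ({r, s, d} : Set V) ρ, B ∉ T ∧ x ∈ B ∧
        Conn ends (inB ends r s d B ρ) d x} → ∀ y, (openGraph ends (assignC ends T ρ)).Adj v y →
        y ∈ {x | x = d ∨ ∃ B ∈ compsH ends ({r, s, d} : Set V) ρ, B ∉ T ∧ x ∈ B ∧
          Conn ends (inB ends r s d B ρ) d x} := by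
      intro v hv y hvy
      obtain ⟨hne, e, he, hends⟩ := openGraph_adj.1 hvy
      rcases hv with hvd | ⟨B, hB, hBT, hvB, hvc⟩
      · -- from `d`
        rw [hvd] at hends hne
        by_cases hyH : y ∈ ({r, s, d} : Set V)
        · exact (no_terminal_edge hT hends hne hd hyH).elim
        by_cases hyS : y ∈ KH ends ({r, s, d} : Set V) ρ ∪ MH ends ({r, s, d} : Set V) ρ
        · have hyA : y ∈ A0H ends ({r, s, d} : Set V) ρ := mem_A0H.2 ⟨hyS, hyH⟩
          obtain ⟨B, hB, hyB⟩ := exists_block_of_mem_A0H hyA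
          have hρe : ρ e = true := edge_term_sided_true hρ hends hd hyH
          by_cases hBT : B ∈ T
          · exfalso
            have hyU : y ∈ unionT T := mem_unionT.2 ⟨B, hBT, hyB⟩
            rw [assignC_eq_not_of_mem hends (Or.inr hyU), hρe] at he
            exact absurd he (by decide)
          · refine Or.inr ⟨B, hB, hBT, hyB, conn_of_openAdj ⟨e, ?_, hends⟩⟩
            exact inB_eq_true_iff.2 ⟨⟨d, Or.inr hd, y, Or.inl (Finset.mem_coe.2 hyB), hends⟩, hρe⟩
        · exfalso
          have hρe : ρ e = false :=
            edge_KH_out_false hends (mem_KH_iff.2 ⟨d, hd, conn_refl _ _ _⟩) (fun h => hyS (Or.inl h))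
          rw [assignC_eq_of_notMem hends (term_notMem_unionT hTc hd) (out_notMem_unionT hTc hyS),
            hρe] at he
          exact absurd he (by decide)
      · -- from a vertex of an unswitched block `B`
        have hvU : v ∉ unionT T := notMem_unionT_of_mem_of_notMem hTc hB hBT hvB
        have hvA : v ∈ A0H ends ({r, s, d} : Set V) ρ := subset_A0H_of_mem_compsH hB hvB
        by_cases hyH : y ∈ ({r, s, d} : Set V)
        · have hyU : y ∉ unionT T := term_notMem_unionT hTc hyH
          have hρe : ρ e = true := by
            rw [← assignC_eq_of_notMem (T := T) (ρ := ρ) hends hvU hyU]; exact he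
          have hc : Conn ends (inB ends r s d B ρ) d y := conn_trans hvc (conn_of_openAdj ⟨e,
            inB_eq_true_iff.2 ⟨⟨v, Or.inl (Finset.mem_coe.2 hvB), y, Or.inr hyH, hends⟩, hρe⟩, hends⟩)
          simp only [Set.mem_insert_iff, Set.mem_singleton_iff] at hyH
          rcases hyH with rfl | rfl | rfl
          · exact absurd (Or.inl hc) (hno B hB hBT)
          · exact absurd (Or.inr hc) (hno B hB hBT)
          · exact Or.inl rfl
        by_cases hyS : y ∈ KH ends ({r, s, d} : Set V) ρ ∪ MH ends ({r, s, d} : Set V) ρ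
        · have hyA : y ∈ A0H ends ({r, s, d} : Set V) ρ := mem_A0H.2 ⟨hyS, hyH⟩
          have hyB : y ∈ B := mem_of_adj_of_mem_compsH hB hends hvB hyA
          have hyU : y ∉ unionT T := notMem_unionT_of_mem_of_notMem hTc hB hBT hyB
          have hρe : ρ e = true := by
            rw [← assignC_eq_of_notMem (T := T) (ρ := ρ) hends hvU hyU]; exact he
          refine Or.inr ⟨B, hB, hBT, hyB, conn_trans hvc (conn_of_openAdj ⟨e, ?_, hends⟩)⟩
          exact inB_eq_true_iff.2 ⟨⟨v, Or.inl (Finset.mem_coe.2 hvB), y,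
            Or.inl (Finset.mem_coe.2 hyB), hends⟩, hρe⟩
        · exfalso
          have hρe : ρ e = false :=
            edge_KH_out_false hends (mem_KH_of_mem_A0H hρ hvA) (fun h => hyS (Or.inl h))
          rw [assignC_eq_of_notMem hends hvU (out_notMem_unionT hTc hyS), hρe] at he
          exact absurd he (by decide)
    have hrZ : r ∉ {x | x = d ∨ ∃ B ∈ compsH ends ({r, s, d} : Set V) ρ, B ∉ T ∧ x ∈ B ∧
        Conn ends (inB ends r s d B ρ) d x} := by
      rintro (h | ⟨B, hB, _, hrB, _⟩)
      · exact hT.rd h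
      · exact term_notMem_A0H hr (subset_A0H_of_mem_compsH hB hrB)
    have hsZ : s ∉ {x | x = d ∨ ∃ B ∈ compsH ends ({r, s, d} : Set V) ρ, B ∉ T ∧ x ∈ B ∧
        Conn ends (inB ends r s d B ρ) d x} := by
      rintro (h | ⟨B, hB, _, hsB, _⟩)
      · exact hT.sd h
      · exact term_notMem_A0H hs (subset_A0H_of_mem_compsH hB hsB)
    rcases mem_K2_iff.1 hK with hc | hc
    · exact hrZ (mem_of_conn_of_closed key (Or.inl rfl) (conn_symm hc))
    · exact hsZ (mem_of_conn_of_closed key (Or.inl rfl) (conn_symm hc))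
  · rintro ⟨B, hB, hBT, hj⟩
    -- a `Y`-path inside `B ∪ H` survives the switch of the other blocks
    have htr : ∀ {a b : V}, Conn ends (inB ends r s d B ρ) a b → Conn ends (assignC ends T ρ) a b := by
      intro a b hab
      have key : ∀ v, v ∈ {x | Conn ends (assignC ends T ρ) a x} → ∀ y,
          (openGraph ends (inB ends r s d B ρ)).Adj v y →
            y ∈ {x | Conn ends (assignC ends T ρ) a x} := by
        intro v hv y hvy
        obtain ⟨_, e, he, hends⟩ := openGraph_adj.1 hvy
        obtain ⟨⟨c, hc, c', hc', hcc'⟩, hρe⟩ := inB_eq_true_iff.1 he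
        have hnot : ∀ z, z ∈ (↑B : Set V) ∪ ({r, s, d} : Set V) → z ∉ unionT T := by
          intro z hz
          rcases hz with hz | hz
          · exact notMem_unionT_of_mem_of_notMem hTc hB hBT (Finset.mem_coe.1 hz)
          · exact term_notMem_unionT hTc hz
        have he' : assignC ends T ρ e = true := by
          rw [hends] at hcc'
          rcases Sym2.eq_iff.1 hcc' with ⟨hvc, hyc'⟩ | ⟨hvc', hyc⟩
          · rw [assignC_eq_of_notMem hends (hvc ▸ hnot c hc) (hyc' ▸ hnot c' hc')]; exact hρe
          · rw [assignC_eq_of_notMem hends (hvc' ▸ hnot c' hc') (hyc ▸ hnot c hc)]; exact hρe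
        exact conn_trans hv (conn_of_openAdj ⟨e, he', hends⟩)
      exact mem_of_conn_of_closed key (conn_refl _ _ _) hab
    rcases hj with hj | hj
    · exact mem_K2_iff.2 (Or.inl (conn_symm (htr hj)))
    · exact mem_K2_iff.2 (Or.inr (conn_symm (htr hj)))


end Claims

end TermSwitch

end Summit.Ventures.PercRepro2
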